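import Literature.Probability.Percolation.KozmaNitzanPreFKG
import HarnessLib

/-!
# Kozma–Nitzan's Theorem 1 with its printed coefficients: inequality (6)

Topic `Literature/Probability/Percolation`.  Companion of `KozmaNitzanPreFKG.lean`, whose
`KNPreFKG.preFKG_pair` / `KozmaNitzan2024_thm1` transcribe Theorem 1 of

* G. Kozma, E. Nitzan, *A reduction of the θ(p_c) = 0 problem to a conjectured inequality*,
  arXiv:2401.12397 (2024), p. 7,

in the MIN form of the pre-FKG conjecture (3), "`P(0 ↔ b, 0 ↔ A) ≥ min{P(0 ↔ A, a ↔ b) : a ∈ A}`"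
for `A = {a₁, a₂}`, and say in the docstring of `preFKG_pair` that the printed proof "combine[s]
them with the coefficients (5) instead".  This file records the printed, STRONGER statement: the
right-hand side may be taken to be a specific CONVEX COMBINATION of the two quantities
`P(0 ↔ A, aᵢ ↔ b)`, with Kozma–Nitzan's coefficients.  Verbatim (pp. 7–8; `φ` is the notation of
Lemma 2, p. 6: "`φ(X) := P(0 ↔ A(X) | A(X) ↮ A(Xᶜ))`", so that for `A = {a₁, a₂}`,
`φ(1) = P(0 ↔ a₁ | a₁ ↮ a₂)` and `φ(2) = P(0 ↔ a₂ | a₁ ↮ a₂)`):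

> "Theorem 1. The pre-FKG conjecture (3) holds when `|A| = 2`.
>  Proof. Recall the notation `φ` from lemma 2 and denote for brevity `φ(1) := φ({1})` and
>  `φ(2) := φ({2})`. Denote `α := φ(1)/(φ(1) + φ(2))`, `β := φ(2)/(φ(1) + φ(2))`. (5)
>  The theorem will follow if we prove that
>  `P(0 ↔ b ↔ A) ≥ α P(0 ↔ A, a₁ ↔ b) + β P(0 ↔ A, a₂ ↔ b)`, (6)
>  so we focus on proving (6). Since `α + β = 1` this is the same as
>  `(α + β) P(0 ↔ b ↔ A) ≥ α P(0 ↔ A, a₁ ↔ b) + β P(0 ↔ A, a₂ ↔ b)`. Shifting everything to the left,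
>  and subtracting some common events from both couples (e.g. `0 ↔ a₁ ↔ b` for the first couple) we
>  get that we need to show
>  `L := α (P(0 ↔ a₂ ↔ b, a₁ ↮ a₂) − P(0 ↔ a₂, a₁ ↔ b, a₁ ↮ a₂))`
>  `     + β (P(0 ↔ a₁ ↔ b, a₁ ↮ a₂) − P(0 ↔ a₁, a₂ ↔ b, a₁ ↮ a₂)) ≥ 0`.
>  Applying BHK 4 times gives
>  `L ≥ α (P(0 ↔ a₂ | a₁ ↮ a₂) P(a₂ ↔ b, a₁ ↮ a₂) − P(0 ↔ a₂ | a₁ ↮ a₂) P(a₁ ↔ b, a₁ ↮ a₂))`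
>  `   + β (P(0 ↔ a₁ | a₁ ↮ a₂) P(a₁ ↔ b, a₁ ↮ a₂) − P(0 ↔ a₁ | a₁ ↮ a₂) P(a₂ ↔ b, a₁ ↮ a₂))`
>  `  = P(a₂ ↔ b, a₁ ↮ a₂)(αφ(2) − βφ(1)) + P(a₁ ↔ b, a₁ ↮ a₂)(−αφ(2) + βφ(1)) = 0`,
>  where the first equality is simply collecting terms and using the definition of `φ`, while the
>  second equality is due to our definition of `α` and `β`. Thus (6) is proved and so is the
>  theorem. □
>  Remark. It is also possible to prove theorem 1 as a corollary of lemma 3, but such a proof would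
>  not give the coefficients in (5), which we find intriguing. We go back to this issue in § 5.2."

(§ 5.2 is the `|A| = 3` harmonic system, Theorem 11, in the tree as
`KozmaNitzan2024_thm11` / `KNHarmonic.*`, files `KozmaNitzanHarmonicCoefficients.lean`,
`KozmaNitzanHarmonicSumGeOne.lean`.)

## Transcription

Vocabulary of `KozmaNitzanPreFKG.lean`: `w : Sym2 V → [0,1]`, `μ = prodBernoulli w`,
`{x ↔ y} = openConn x y`, `{0 ↔ A} = {0 ↔ a₁} ∪ {0 ↔ a₂}`, `D = {a₁ ↮ a₂} = (openConn a₁ a₂)ᶜ`.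
Since `φ(1)` and `φ(2)` have the common denominator `μ(D)`, the coefficients (5) are
`α = μ(D ∩ {0 ↔ a₁}) / (μ(D ∩ {0 ↔ a₁}) + μ(D ∩ {0 ↔ a₂}))`, `β` likewise, whenever the denominator is
positive; we first prove the division-free form

  `(μ(D, 0 ↔ a₁) + μ(D, 0 ↔ a₂)) · P(0 ↔ b, 0 ↔ A) ≥ μ(D, 0 ↔ a₁) · P(0 ↔ A, a₁ ↔ b) + μ(D, 0 ↔ a₂) · P(0 ↔ A, a₂ ↔ b)`

(`KNPreFKG.preFKG_pair_coeff`; when `μ(D) = 0` both sides vanish), then the printed normalised form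
(6) under `0 < μ(D, 0 ↔ a₁) + μ(D, 0 ↔ a₂)` (`KozmaNitzan2024_thm1_coeff`, with `α + β = 1`:
`KozmaNitzan2024_thm1_coeff_sum`).  "The theorem will follow if we prove (6)": the min of the two
quantities `P(0 ↔ A, aᵢ ↔ b)` is at most their `(α, β)`-convex combination — that min form is the tree's
`KNPreFKG.preFKG_pair` / `KozmaNitzan2024_thm1_holds` (not restated here).  The proof is the printed
one step by step: the two "subtract the common event" identities
and "BHK 4 times" (BHK 2006 Thm. 1.3 inside `C_{a₂}` resp. `C_{a₁}`, Thm. 1.4 across the two clusters,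
given `D`; tree `KNPreFKG.bhk_one_upper_upper`, `KNPreFKG.bhk_two_upper_upper`), which bound the two
bracketed differences of `L` below exactly as displayed; the linear combination with `α, β` then
cancels identically.  TRANSCRIPTION FACT: none — the degenerate case `φ(1) + φ(2) = 0` (then (5) is
`0/0`) is the only place where the division-free form says more than the print, and there (6) is
vacuous while Theorem 1 still holds (both `P(0 ↔ A, aᵢ ↔ b, a₁ ↮ a₂)` vanish and the common events
carry the inequality), as `preFKG_pair` already records.

## References
* G. Kozma, E. Nitzan, arXiv:2401.12397 (2024), Lemma 2 (p. 6), Theorem 1 with (5)–(6) and the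
  Remark (pp. 7–8), § 5.2 (pp. 32–34). [KozmaNitzan2024]
* J. van den Berg, O. Häggström, J. Kahn, *Some conditional correlation inequalities for percolation
  and related processes*, Random Structures Algorithms 29 (2006) 417–435, Thms. 1.3, 1.4.
  [VandenbergHaggstromKahn2005]
-/

noncomputable section

open MeasureTheory Set
open Literature.Probability.LatticeModels (prodBernoulli)

namespace Literature.Probability.Percolation

variable {V : Type*}

namespace KNPreFKG

variable [Fintype V]

/-- **Kozma–Nitzan's inequality (6), division-free form.**  With `D = {a₁ ↮ a₂}`,
`{0 ↔ A} = {0 ↔ a₁} ∪ {0 ↔ a₂}`: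
`μ(D ∩ {0↔a₁}) · μ({0↔A} ∩ {a₁↔b}) + μ(D ∩ {0↔a₂}) · μ({0↔A} ∩ {a₂↔b})`
`  ≤ (μ(D ∩ {0↔a₁}) + μ(D ∩ {0↔a₂})) · μ({0↔b} ∩ {0↔A})`,
i.e. (6) multiplied through by `(φ(1) + φ(2)) · μ(D)`.  Printed proof: the two "subtract the common
event" identities and "BHK 4 times"; the `α, β`-combination of the four BHK bounds cancels
identically. [cite: KozmaNitzan2024, Thm. 1, (5)–(6) (pp. 7–8)] -/
theorem preFKG_pair_coeff (w : Sym2 V → unitInterval) (o b a₁ a₂ : V) :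
    (prodBernoulli w).real ((openConn a₁ a₂)ᶜ ∩ openConn o a₁) *
        (prodBernoulli w).real ((openConn o a₁ ∪ openConn o a₂) ∩ openConn a₁ b) +
      (prodBernoulli w).real ((openConn a₁ a₂)ᶜ ∩ openConn o a₂) *
        (prodBernoulli w).real ((openConn o a₁ ∪ openConn o a₂) ∩ openConn a₂ b) ≤
    ((prodBernoulli w).real ((openConn a₁ a₂)ᶜ ∩ openConn o a₁) +
        (prodBernoulli w).real ((openConn a₁ a₂)ᶜ ∩ openConn o a₂)) *
      (prodBernoulli w).real (openConn o b ∩ (openConn o a₁ ∪ openConn o a₂)) := by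
  classical
  by_cases h12 : a₁ = a₂
  · -- `A` is a singleton: `D = ∅`, every coefficient vanishes
    subst h12
    have hD : ((openConn a₁ a₁)ᶜ : Set (BondConfig V)) = ∅ := by
      ext ω
      simp only [mem_compl_iff, openConn, mem_setOf_eq, mem_empty_iff_false, iff_false, not_not]
      exact SimpleGraph.Reachable.refl _
    simp [hD]
  set μ := prodBernoulli w with hμ
  set O₁ : Set (BondConfig V) := openConn o a₁ with hO₁
  set O₂ : Set (BondConfig V) := openConn o a₂ with hO₂
  set Ob : Set (BondConfig V) := openConn o b with hOb
  set B₁ : Set (BondConfig V) := openConn a₁ b with hB₁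
  set B₂ : Set (BondConfig V) := openConn a₂ b with hB₂
  set D : Set (BondConfig V) := {ω | ¬ (openGraph ω).Reachable a₁ a₂} with hD
  have hDc : ((openConn a₁ a₂)ᶜ : Set (BondConfig V)) = D := by
    ext ω
    simp [hD, openConn]
  rw [hDc]
  set E : Set (BondConfig V) := Ob ∩ (O₁ ∪ O₂) with hE
  set F₁ : Set (BondConfig V) := (O₁ ∪ O₂) ∩ B₁ with hF₁
  set F₂ : Set (BondConfig V) := (O₁ ∪ O₂) ∩ B₂ with hF₂
  have hsplit : ∀ A S : Set (BondConfig V), μ.real A = μ.real (A ∩ S) + μ.real (A ∩ Sᶜ) := by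
    intro A S
    rw [← measureReal_inter_add_sdiff (s := A) (MeasurableSet.of_discrete : MeasurableSet S), Set.sdiff_eq]
  -- the two "subtract the common event" identities (p. 7: "subtracting some common events from
  -- both couples (e.g. 0 ↔ a₁ ↔ b for the first couple)")
  have hE1 : E ∩ O₁ = F₁ ∩ O₁ := by
    ext ω
    simp only [mem_inter_iff, mem_union, hE, hF₁, hO₁, hO₂, hOb, hB₁, openConn, mem_setOf_eq]
    constructor
    · rintro ⟨⟨hb, _⟩, h1⟩
      exact ⟨⟨Or.inl h1, h1.symm.trans hb⟩, h1⟩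
    · rintro ⟨⟨_, hb⟩, h1⟩
      exact ⟨⟨h1.trans hb, Or.inl h1⟩, h1⟩
  have hE1c : E ∩ O₁ᶜ = O₂ ∩ B₂ ∩ D := by
    ext ω
    simp only [mem_inter_iff, mem_union, mem_compl_iff, hE, hO₁, hO₂, hOb, hB₂, hD, openConn,
      mem_setOf_eq]
    constructor
    · rintro ⟨⟨hb, h1 | h2⟩, hn1⟩
      · exact absurd h1 hn1
      · exact ⟨⟨h2, h2.symm.trans hb⟩, fun h => hn1 (h2.trans h.symm)⟩
    · rintro ⟨⟨h2, hb⟩, hn⟩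
      exact ⟨⟨h2.trans hb, Or.inr h2⟩, fun h1 => hn (h1.symm.trans h2)⟩
  have hF1c : F₁ ∩ O₁ᶜ = O₂ ∩ B₁ ∩ D := by
    ext ω
    simp only [mem_inter_iff, mem_union, mem_compl_iff, hF₁, hO₁, hO₂, hB₁, hD, openConn,
      mem_setOf_eq]
    constructor
    · rintro ⟨⟨h1 | h2, hb⟩, hn1⟩
      · exact absurd h1 hn1
      · exact ⟨⟨h2, hb⟩, fun h => hn1 (h2.trans h.symm)⟩
    · rintro ⟨⟨h2, hb⟩, hn⟩
      exact ⟨⟨Or.inr h2, hb⟩, fun h1 => hn (h1.symm.trans h2)⟩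
  have hE2 : E ∩ O₂ = F₂ ∩ O₂ := by
    ext ω
    simp only [mem_inter_iff, mem_union, hE, hF₂, hO₁, hO₂, hOb, hB₂, openConn, mem_setOf_eq]
    constructor
    · rintro ⟨⟨hb, _⟩, h2⟩
      exact ⟨⟨Or.inr h2, h2.symm.trans hb⟩, h2⟩
    · rintro ⟨⟨_, hb⟩, h2⟩
      exact ⟨⟨h2.trans hb, Or.inr h2⟩, h2⟩
  have hE2c : E ∩ O₂ᶜ = O₁ ∩ B₁ ∩ D := by
    ext ω
    simp only [mem_inter_iff, mem_union, mem_compl_iff, hE, hO₁, hO₂, hOb, hB₁, hD, openConn,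
      mem_setOf_eq]
    constructor
    · rintro ⟨⟨hb, h1 | h2⟩, hn2⟩
      · exact ⟨⟨h1, h1.symm.trans hb⟩, fun h => hn2 (h1.trans h)⟩
      · exact absurd h2 hn2
    · rintro ⟨⟨h1, hb⟩, hn⟩
      exact ⟨⟨h1.trans hb, Or.inl h1⟩, fun h2 => hn (h1.symm.trans h2)⟩
  have hF2c : F₂ ∩ O₂ᶜ = O₁ ∩ B₂ ∩ D := by
    ext ω
    simp only [mem_inter_iff, mem_union, mem_compl_iff, hF₂, hO₁, hO₂, hB₂, hD, openConn,
      mem_setOf_eq]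
    constructor
    · rintro ⟨⟨h1 | h2, hb⟩, hn2⟩
      · exact ⟨⟨h1, hb⟩, fun h => hn2 (h1.trans h)⟩
      · exact absurd h2 hn2
    · rintro ⟨⟨h1, hb⟩, hn⟩
      exact ⟨⟨Or.inl h1, hb⟩, fun h2 => hn (h1.symm.trans h2)⟩
  -- p. 7: `L = α (P(0↔a₂↔b, D) − P(0↔a₂, a₁↔b, D)) + β (P(0↔a₁↔b, D) − P(0↔a₁, a₂↔b, D))`
  have hdiff1 : μ.real E - μ.real F₁ = μ.real (O₂ ∩ B₂ ∩ D) - μ.real (O₂ ∩ B₁ ∩ D) := by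
    rw [hsplit E O₁, hsplit F₁ O₁, hE1, hE1c, hF1c]
    ring
  have hdiff2 : μ.real E - μ.real F₂ = μ.real (O₁ ∩ B₁ ∩ D) - μ.real (O₁ ∩ B₂ ∩ D) := by
    rw [hsplit E O₂, hsplit F₂ O₂, hE2, hE2c, hF2c]
    ring
  -- p. 8: "Applying BHK 4 times", given `D = {a₁ ↮ a₂}`
  have hD1 : {ω : BondConfig V | ∀ x ∈ ({a₂} : Set V), ¬ (openGraph ω).Reachable a₁ x} = D := by
    ext ω
    simp [hD]
  have hD2 : {ω : BondConfig V | ∀ x ∈ ({a₁} : Set V), ¬ (openGraph ω).Reachable a₂ x} = D := by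
    ext ω
    simp only [mem_setOf_eq, mem_singleton_iff, forall_eq, hD]
    exact not_congr ⟨SimpleGraph.Reachable.symm, SimpleGraph.Reachable.symm⟩
  have hD3 : {ω : BondConfig V | ¬ (openGraph ω).Reachable a₂ a₁} = D := by
    ext ω
    simp only [mem_setOf_eq, hD]
    exact not_congr ⟨SimpleGraph.Reachable.symm, SimpleGraph.Reachable.symm⟩
  -- (i) `μ(D, 0↔a₂) μ(D, a₂↔b) ≤ μ(D) μ(D, 0↔a₂, a₂↔b)` (Thm. 1.3 in `C_{a₂}`)
  have h_i := bhk_one_upper_upper w a₂ ({a₁} : Set V) (by simpa using Ne.symm h12)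
    (isUpperSet_connFamily a₂ o) (isUpperSet_connFamily a₂ b)
  rw [hD2, ← openConn_eq_setOf_connFamily, ← openConn_eq_setOf_connFamily, openConn_symm a₂ o] at h_i
  -- (ii) `μ(D) μ(D, 0↔a₂, a₁↔b) ≤ μ(D, 0↔a₂) μ(D, a₁↔b)` (Thm. 1.4, `C_{a₂}` and `C_{a₁}`)
  have h_ii := bhk_two_upper_upper w a₂ a₁ (Ne.symm h12) (isUpperSet_connFamily a₂ o)
    (isUpperSet_connFamily a₁ b)
  rw [hD3, ← openConn_eq_setOf_connFamily, ← openConn_eq_setOf_connFamily, openConn_symm a₂ o] at h_ii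
  -- (iii) `μ(D, 0↔a₁) μ(D, a₁↔b) ≤ μ(D) μ(D, 0↔a₁, a₁↔b)` (Thm. 1.3 in `C_{a₁}`)
  have h_iii := bhk_one_upper_upper w a₁ ({a₂} : Set V) (by simpa using h12)
    (isUpperSet_connFamily a₁ o) (isUpperSet_connFamily a₁ b)
  rw [hD1, ← openConn_eq_setOf_connFamily, ← openConn_eq_setOf_connFamily, openConn_symm a₁ o] at h_iii
  -- (iv) `μ(D) μ(D, 0↔a₁, a₂↔b) ≤ μ(D, 0↔a₁) μ(D, a₂↔b)` (Thm. 1.4, `C_{a₁}` and `C_{a₂}`)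
  have h_iv := bhk_two_upper_upper w a₁ a₂ h12 (isUpperSet_connFamily a₁ o)
    (isUpperSet_connFamily a₂ b)
  rw [← openConn_eq_setOf_connFamily, ← openConn_eq_setOf_connFamily, openConn_symm a₁ o] at h_iv
  -- normalise the intersections
  have e1 : D ∩ (O₂ ∩ B₂) = O₂ ∩ B₂ ∩ D := inter_comm _ _
  have e2 : D ∩ (O₂ ∩ B₁) = O₂ ∩ B₁ ∩ D := inter_comm _ _
  have e3 : D ∩ (O₁ ∩ B₁) = O₁ ∩ B₁ ∩ D := inter_comm _ _
  have e4 : D ∩ (O₁ ∩ B₂) = O₁ ∩ B₂ ∩ D := inter_comm _ _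
  simp only [← hD, ← hO₁, ← hO₂, ← hB₁, ← hB₂] at h_i h_ii h_iii h_iv
  rw [e1] at h_i
  rw [e2] at h_ii
  rw [e3] at h_iii
  rw [e4] at h_iv
  -- the printed lower bounds for the two brackets of `L`, each multiplied by `μ(D)`:
  -- `μ(D)·(μE − μF₁) ≥ μ(D,0↔a₂)·(μ(D,a₂↔b) − μ(D,a₁↔b))` ("`≥ φ(2)(…)`") and symmetrically
  have key1 : μ.real D * (μ.real E - μ.real F₁) ≥
      μ.real (D ∩ O₂) * (μ.real (D ∩ B₂) - μ.real (D ∩ B₁)) := by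
    rw [hdiff1, mul_sub, mul_sub]
    linarith [h_i, h_ii]
  have key2 : μ.real D * (μ.real E - μ.real F₂) ≥
      μ.real (D ∩ O₁) * (μ.real (D ∩ B₁) - μ.real (D ∩ B₂)) := by
    rw [hdiff2, mul_sub, mul_sub]
    linarith [h_iii, h_iv]
  -- "collecting terms … the second equality is due to our definition of α and β": with the
  -- un-normalised coefficients `μ(D ∩ O₁)`, `μ(D ∩ O₂)` the two lower bounds cancel exactly, so
  -- `μ(D) · [μ(D∩O₁)(μE − μF₁) + μ(D∩O₂)(μE − μF₂)] ≥ 0`.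
  have hsum : μ.real D * (μ.real (D ∩ O₁) * (μ.real E - μ.real F₁) +
      μ.real (D ∩ O₂) * (μ.real E - μ.real F₂)) ≥ 0 := by
    have hO1n : 0 ≤ μ.real (D ∩ O₁) := measureReal_nonneg
    have hO2n : 0 ≤ μ.real (D ∩ O₂) := measureReal_nonneg
    have := add_le_add (mul_le_mul_of_nonneg_left key1 hO1n) (mul_le_mul_of_nonneg_left key2 hO2n)
    nlinarith [this]
  by_cases hD0 : μ.real D = 0
  · -- degenerate case: `μ(D) = 0` forces both coefficients to vanish
    have hz : ∀ A : Set (BondConfig V), μ.real (D ∩ A) = 0 := fun A =>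
      le_antisymm ((measureReal_mono inter_subset_left).trans hD0.le) measureReal_nonneg
    rw [hz, hz]
    simp
  · have hDpos : 0 < μ.real D := lt_of_le_of_ne measureReal_nonneg (Ne.symm hD0)
    have : μ.real (D ∩ O₁) * (μ.real E - μ.real F₁) + μ.real (D ∩ O₂) * (μ.real E - μ.real F₂) ≥ 0 :=
      nonneg_of_mul_nonneg_right (by simpa [mul_comm] using hsum) hDpos
    nlinarith [this]

end KNPreFKG

/-- **Kozma–Nitzan 2024, Theorem 1 with the coefficients (5): inequality (6)** (arXiv:2401.12397,
pp. 7–8).  For a finite graph with arbitrary edge probabilities (weights `w : Sym2 V → [0,1]`,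
`μ = prodBernoulli w`), vertices `0, b` and `A = {a₁, a₂}`, put `D = {a₁ ↮ a₂}`,
`φ(i) = P(0 ↔ aᵢ | a₁ ↮ a₂)` (Lemma 2's `φ({i})`), and, when `φ(1) + φ(2) > 0`,
`α = φ(1)/(φ(1)+φ(2))`, `β = φ(2)/(φ(1)+φ(2))` — equivalently (common denominator `μ(D)`)
`α = μ(D ∩ {0↔a₁}) / (μ(D ∩ {0↔a₁}) + μ(D ∩ {0↔a₂}))`, `β = μ(D ∩ {0↔a₂}) / (…)`.  Then
"`P(0 ↔ b ↔ A) ≥ α P(0 ↔ A, a₁ ↔ b) + β P(0 ↔ A, a₂ ↔ b)`" (6), with `{0 ↔ A} = {0↔a₁} ∪ {0↔a₂}`.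
This is the printed strengthening of the min form `KozmaNitzan2024_thm1` ("such a proof would not
give the coefficients in (5), which we find intriguing", Remark p. 8).
[cite: KozmaNitzan2024, Thm. 1, (5)–(6) (pp. 7–8); Lemma 2 (p. 6)] -/
theorem KozmaNitzan2024_thm1_coeff [Fintype V] (w : Sym2 V → unitInterval) (o b a₁ a₂ : V)
    (hφ : 0 < (prodBernoulli w).real ((openConn a₁ a₂)ᶜ ∩ openConn o a₁) +
      (prodBernoulli w).real ((openConn a₁ a₂)ᶜ ∩ openConn o a₂)) :
    (prodBernoulli w).real ((openConn a₁ a₂)ᶜ ∩ openConn o a₁) /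
          ((prodBernoulli w).real ((openConn a₁ a₂)ᶜ ∩ openConn o a₁) +
            (prodBernoulli w).real ((openConn a₁ a₂)ᶜ ∩ openConn o a₂)) *
        (prodBernoulli w).real ((openConn o a₁ ∪ openConn o a₂) ∩ openConn a₁ b) +
      (prodBernoulli w).real ((openConn a₁ a₂)ᶜ ∩ openConn o a₂) /
          ((prodBernoulli w).real ((openConn a₁ a₂)ᶜ ∩ openConn o a₁) +
            (prodBernoulli w).real ((openConn a₁ a₂)ᶜ ∩ openConn o a₂)) *
        (prodBernoulli w).real ((openConn o a₁ ∪ openConn o a₂) ∩ openConn a₂ b) ≤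
    (prodBernoulli w).real (openConn o b ∩ (openConn o a₁ ∪ openConn o a₂)) := by
  have h := KNPreFKG.preFKG_pair_coeff w o b a₁ a₂
  set c₁ := (prodBernoulli w).real ((openConn a₁ a₂)ᶜ ∩ openConn o a₁) with hc₁
  set c₂ := (prodBernoulli w).real ((openConn a₁ a₂)ᶜ ∩ openConn o a₂) with hc₂
  set f₁ := (prodBernoulli w).real ((openConn o a₁ ∪ openConn o a₂) ∩ openConn a₁ b) with hf₁
  set f₂ := (prodBernoulli w).real ((openConn o a₁ ∪ openConn o a₂) ∩ openConn a₂ b) with hf₂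
  set e := (prodBernoulli w).real (openConn o b ∩ (openConn o a₁ ∪ openConn o a₂)) with he
  rw [div_mul_eq_mul_div, div_mul_eq_mul_div, ← add_div, div_le_iff₀ hφ]
  linarith [h]

/-- The coefficients (5) sum to one: `α + β = 1` ("Since `α + β = 1` …", p. 7), in the transcription
of `KozmaNitzan2024_thm1_coeff`. [cite: KozmaNitzan2024, (5) (p. 7)] -/
theorem KozmaNitzan2024_thm1_coeff_sum [Fintype V] (w : Sym2 V → unitInterval) (o a₁ a₂ : V)
    (hφ : 0 < (prodBernoulli w).real ((openConn a₁ a₂)ᶜ ∩ openConn o a₁) +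
      (prodBernoulli w).real ((openConn a₁ a₂)ᶜ ∩ openConn o a₂)) :
    (prodBernoulli w).real ((openConn a₁ a₂)ᶜ ∩ openConn o a₁) /
          ((prodBernoulli w).real ((openConn a₁ a₂)ᶜ ∩ openConn o a₁) +
            (prodBernoulli w).real ((openConn a₁ a₂)ᶜ ∩ openConn o a₂)) +
      (prodBernoulli w).real ((openConn a₁ a₂)ᶜ ∩ openConn o a₂) /
          ((prodBernoulli w).real ((openConn a₁ a₂)ᶜ ∩ openConn o a₁) +
            (prodBernoulli w).real ((openConn a₁ a₂)ᶜ ∩ openConn o a₂)) = 1 := by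
  rw [← add_div, div_self hφ.ne']

end Literature.Probability.Percolation
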